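import Summits.BirchSwinnertonDyer.BirchSwinnertonDyer.Theses.PrintX9
import Summits.BirchSwinnertonDyer.BirchSwinnertonDyer.Theorems.PrintX9HowardRankOneMultiCarrier
import Summits.BirchSwinnertonDyer.Rank1Residual.X11b.YZCompositeOfFrames
import HarnessLib

/-!
# Route `PrintX9`: the ASSEMBLY CANDIDATE of the Howard road, in the route's ITEM CURRENCY —
# `HeegnerFrameSupplyMultiCarrierX9 → (MZ26 Cor 4.6) → (YZ/BCS/CGLS composite) → JetchevPrintFactsX9 →
# MuTransfer → AnalyticMuZeroX9 → HeegnerPrintFactsX9 → CyclotomicPrintFactsX9 → Rank1Residual.BSDpOnClassX9`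
# (cell `bsd-print-x9`, prover seat p4, gen 3; booking option (B) of HOME/p4/howard-road-g3.md)

HONEST FRAMING (cell `run/shared/lean/pub/bsd-print-x9/`, D-0131 print tier): THEOREMS ONLY, nothing
booked, the leaf is NOT closed. The route's proved `Assembly` (20531) reads `HeegnerDivisibilityX9 (J) →
MuTransfer → AnalyticMuZeroX9 → HeegnerPrintFactsX9 → CyclotomicPrintFactsX9 → BSDpOnClassX9`; after the
split of J (plan g3, 21:27Z) its open Heegner reading is the crux `MultiPrimeX9` (stmt-22889; no print at
any image). This file states, with every EXISTING item BY NAME and the three not-yet-items spelled out,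
the alternative assembly that the Howard road proves (`PrintX9HowardRankOneMultiCarrier.lean`, p572712):
J is replaced by (i) its kernel single-carrier half fed by the support child `JetchevPrintFactsX9`
(stmt-22890, the three image-free print heads) and (ii) on the MULTI-CARRIER rank-one pairs a Heegner
FRAME with `p ∤ h_K` and `L(E^{d_K},1) ≠ 0` (`hFS`, the proposed crux `HeegnerFrameSupplyMultiCarrierX9`:
per pair a finite certificate, class-wide beyond print), through Mastella–Zerman 2026 Cor. 4.6 (`h46`,
flag-free PUB) and the Yan–Zhu 5.7 (1)/5.9 + BCS 4.2.2 + CGLS 5.1.3 composite (`hYZ`, flag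
`YZ26-57i+59+BCS422+CGLS513-composite` — REF-85: leaf closures through it are outside PARTITION currency
until the flag is lifted; ty1 g16 is deriving it from the four single-source facts). If the planner files
the three binders as items and re-glues `Assembly`, the new assembly is this theorem by one `exact`.

References: [MastellaZerman2026] Cor. 4.6; [YanZhu2024MainConjNonCM] Thm. 5.7 (1), 5.9;
[BurungaleCastellaSkinner2025] Prop. 4.2.2, Cor. 1.3.1; [Jetchev2008] Thm. 1.4; [JetchevSkinnerWan2017]
Thm. 3.3.1; [Kato2004Asterisque] Thm. 12.5, 17.4; [GreenbergLNM1716] Conj. 1.11, Thm. 4.1; route file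
`Theses/PrintX9.lean` (rev 5).
-/

set_option autoImplicit false
set_option linter.dupNamespace false

noncomputable section

open Literature.NumberTheory.EllipticCurves

namespace Summit.BirchSwinnertonDyer.BirchSwinnertonDyer.Rank1Residual

/-- **The Howard-road assembly of route `PrintX9` in item currency**: from the FRAME SUPPLY on the
multi-carrier rank-one X9 pairs (`hFS`, `stub_multiPrime`'s negated clause verbatim), Mastella–Zerman
2026 Cor. 4.6 (`h46`), the Yan–Zhu/BCS/CGLS composite (`hYZ`), and the route's items BY NAME —
`JetchevPrintFactsX9` (stmt-22890), `MuTransfer` (19629), `AnalyticMuZeroX9` (19630),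
`HeegnerPrintFactsX9` (20530), `CyclotomicPrintFactsX9` (20532) — the leaf
`Rank1Residual.BSDpOnClassX9`. One `exact` onto
`bsdpOnClassX9_of_heegnerFrameSupplyMultiCarrier_of_jetchevPrintFacts_of_cor46_of_katoMuTransfer`
(p572712) after destructuring the two bundles in their binder order (as in `assembly_proof`, p542280).
CONDITIONAL on the open items and on `hFS`; nothing booked; `MultiPrimeX9` (22889) is NOT used.
[cite: MastellaZerman2026, Cor. 4.6] [cite: YanZhu2024MainConjNonCM, Thm. 5.7 (1), Thm. 5.9]
[cite: Jetchev2008, Thm. 1.4 (p. 812)] [cite: BurungaleCastellaSkinner2025, Cor. 1.3.1 and its proof (p. 4)]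
[cite: Miller2011LMS, §1 and Def. 1.1] -/
theorem howardAssembly_of_heegnerFrameSupplyMultiCarrier
    (hFS : ∀ (W : WeierstrassCurve ℚ) [W.IsElliptic] [W.IsGloballyMinimal] [NeZero (W.conductorNorm ℤ)]
      (p : ℕ) [Fact p.Prime], Literature.NumberTheory.EllipticCurves.Rank1Residual.ClassX9 W p →
      W.analyticRank = 1 →
      ¬ (∃ (q : ℕ) (_ : Fact q.Prime), q ∣ W.conductorNorm ℤ ∧ padicValNat p W.tamagawaProduct ≤
        padicValNat p ((W.baseChange ℚ_[q]).localTamagawaNumber ℤ_[q])) →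
      ∃ (K : Type) (_ : Field K) (_ : NumberField K), IsImaginaryQuadratic K ∧
        Odd (NumberField.discr K) ∧ NumberField.discr K < -4 ∧
        SatisfiesHeegnerHypothesis (W.conductorNorm ℤ) K ∧ SatisfiesHeegnerHypothesis p K ∧
        ¬ p ∣ NumberField.classNumber K ∧
        (W.quadraticTwist (NumberField.discr K : ℚ)).entireLFunction 1 ≠ 0)
    (h46 : MastellaZerman2026.cor46_howardDivisibility_of_scalarImage.{0})
    (hYZ : YanZhu2026.thm57_thm59_bcs422_cgls513_generator_constantCoeff_of_heegnerDivisibility) :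
    Summit.BirchSwinnertonDyer.BirchSwinnertonDyer.Theses.PrintX9.JetchevPrintFactsX9 →
    Summit.BirchSwinnertonDyer.BirchSwinnertonDyer.Theses.PrintX9.MuTransfer →
    Summit.BirchSwinnertonDyer.BirchSwinnertonDyer.Theses.PrintX9.AnalyticMuZeroX9 →
    Summit.BirchSwinnertonDyer.BirchSwinnertonDyer.Theses.PrintX9.HeegnerPrintFactsX9 →
    Summit.BirchSwinnertonDyer.BirchSwinnertonDyer.Theses.PrintX9.CyclotomicPrintFactsX9 →
    Summit.BirchSwinnertonDyer.BirchSwinnertonDyer.Rank1Residual.BSDpOnClassX9 := by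
  intro hPF h1 h2 hHP hCP
  obtain ⟨hGZ, hKo, hrec, hD36, hChaU, h526, h124a, h331, hnf, hHL, hMaz, hNS⟩ := hHP
  obtain ⟨hBCS, hGr, hGZK, hmod, hpar, h5⟩ := hCP
  exact bsdpOnClassX9_of_heegnerFrameSupplyMultiCarrier_of_jetchevPrintFacts_of_cor46_of_katoMuTransfer
    hGZ hKo hrec hD36 hChaU h526 h124a h331 h46 hYZ hBCS hGr hGZK hmod hpar hnf hHL hMaz hNS h5 hPF hFS
    h1 h2

/-! ### APPEND (p4 g3, after ty1 g16's p575626): the composite flag LIFTED — the assembly from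
single-source print -/

/-- **The Howard-road assembly of route `PrintX9` with the Yan–Zhu/BCS/CGLS composite REPLACED by its
four SINGLE-SOURCE printed inputs** — Yan–Zhu 2026 Thm. 5.7 (1) (`h57`), Thm. 5.9 (`h59`), BCS 2025 Prop.
4.2.2 (`h422`), CGLS 2022 Thm. 5.1.3 (`h513`) — through ty1 g16's kernel derivation
`X11b.YZComposite.thm57_thm59_bcs422_cgls513_of_heegnerDivisibility_of_printFacts_of_modularity`
(p575626; Carayol's level identity from modularity, `hpar` = the fifth conjunct of
`CyclotomicPrintFactsX9`). So the only non-item hypotheses of the Howard-road assembly are `hFS` (the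
frame supply, OPEN) and five PUBLISHED single-source facts (`h46`, `h57`, `h59`, `h422`, `h513`); the
composite flag `YZ26-57i+59+BCS422+CGLS513-composite` (REF-85) no longer rides on it. CONDITIONAL;
nothing booked. [cite: MastellaZerman2026, Cor. 4.6] [cite: YanZhu2024MainConjNonCM, Thm. 5.7 (1), Thm. 5.9]
[cite: BurungaleCastellaSkinner2025, Prop. 4.2.2] [cite: CastellaGrossiLeeSkinner2022, Thm. 5.1.3]
[cite: Miller2011LMS, §1 and Def. 1.1] -/
theorem howardAssembly_of_heegnerFrameSupplyMultiCarrier_of_printFacts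
    (hFS : ∀ (W : WeierstrassCurve ℚ) [W.IsElliptic] [W.IsGloballyMinimal] [NeZero (W.conductorNorm ℤ)]
      (p : ℕ) [Fact p.Prime], Literature.NumberTheory.EllipticCurves.Rank1Residual.ClassX9 W p →
      W.analyticRank = 1 →
      ¬ (∃ (q : ℕ) (_ : Fact q.Prime), q ∣ W.conductorNorm ℤ ∧ padicValNat p W.tamagawaProduct ≤
        padicValNat p ((W.baseChange ℚ_[q]).localTamagawaNumber ℤ_[q])) →
      ∃ (K : Type) (_ : Field K) (_ : NumberField K), IsImaginaryQuadratic K ∧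
        Odd (NumberField.discr K) ∧ NumberField.discr K < -4 ∧
        SatisfiesHeegnerHypothesis (W.conductorNorm ℤ) K ∧ SatisfiesHeegnerHypothesis p K ∧
        ¬ p ∣ NumberField.classNumber K ∧
        (W.quadraticTwist (NumberField.discr K : ℚ)).entireLFunction 1 ≠ 0)
    (h46 : MastellaZerman2026.cor46_howardDivisibility_of_scalarImage.{0})
    (h57 : YanZhu2026.thm57_isTorsion_charIdealXGr_eq_bdpLFunction)
    (h59 : YanZhu2026.thm59_XGr_isTorsion_bdp_iff_heegnerPoint_localised)
    (h422 : BurungaleCastellaSkinner2025.prop422_exists_isBDPLFunction_mu_eq_zero)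
    (h513 : CastellaGrossiLeeSkinner2022.thm513_exists_isBDPLFunction_valueAtOne_disc) :
    Summit.BirchSwinnertonDyer.BirchSwinnertonDyer.Theses.PrintX9.JetchevPrintFactsX9 →
    Summit.BirchSwinnertonDyer.BirchSwinnertonDyer.Theses.PrintX9.MuTransfer →
    Summit.BirchSwinnertonDyer.BirchSwinnertonDyer.Theses.PrintX9.AnalyticMuZeroX9 →
    Summit.BirchSwinnertonDyer.BirchSwinnertonDyer.Theses.PrintX9.HeegnerPrintFactsX9 →
    Summit.BirchSwinnertonDyer.BirchSwinnertonDyer.Theses.PrintX9.CyclotomicPrintFactsX9 →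
    Summit.BirchSwinnertonDyer.BirchSwinnertonDyer.Rank1Residual.BSDpOnClassX9 := by
  intro hPF h1 h2 hHP hCP
  exact howardAssembly_of_heegnerFrameSupplyMultiCarrier hFS h46
    (Summit.BirchSwinnertonDyer.Rank1Residual.X11b.YZComposite.thm57_thm59_bcs422_cgls513_of_heegnerDivisibility_of_printFacts_of_modularity
      h57 h59 h422 h513 hCP.2.2.2.2.1) hPF h1 h2 hHP hCP

end Summit.BirchSwinnertonDyer.BirchSwinnertonDyer.Rank1Residual

end
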